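import Mathlib.Analysis.Calculus.InverseFunctionTheorem.ContDiff
import Mathlib.Analysis.Calculus.FDeriv.Prod
import Mathlib.Analysis.Calculus.ContDiff.Operations
import Mathlib.Topology.OpenPartialHomeomorph.IsImage
import Mathlib.Analysis.Calculus.Deriv.Pow
import Mathlib.Analysis.Calculus.Deriv.Mul
import HarnessLib

/-!
# Gavrilov's functions `F, G` (Lemma 2) and the hodograph chart `(x, α) ↦ (F, G)`

Topic `Literature/Analysis/FluidPDE`; support file for the discharge of the named fact
`Literature.Analysis.FluidPDE.gavrilov_compact_steady_euler` (Gavrilov 2019, §1 Theorem):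
the first half of the smooth-category proof of Gavrilov's Lemma 3.

With the profile `ψ` of Lemma 1 and `H` (Gavrilov 2019, §2.1; constructed as power series in
`GavrilovProfile.lean`, here abstracted as a `Gavrilov.ProfileData` record of exactly the
properties used: `ψ' = χ`, `H' = 4ψ + 24αχ`, `Hχ = 6α + 12αψχ`, smoothness on `(−1, 1)`,
`ψ(0) = 1`, `χ(0) = −3/4`, `H(0) = 0`), Gavrilov defines (§2.1, before Lemma 2)
`F(x, α) = −2xψ(α) + 2x³`, `G(x, α) = 12x²α − F² − H(α)` and proves (Lemma 2)
`(2a) ∂G/∂x + F ∂G/∂α = 2G ∂F/∂α`, `(2b) x ∂F/∂x − F = 4x³`, and notes that at `(x, α) = (1, 0)`: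
`F = G = 0`, `∂F/∂x = 4`, `∂F/∂α = 3/2`, `∂G/∂x = 0`, `∂G/∂α = 8`, so that
`∂(F,G)/∂(x,α)(1,0) = 32 ≠ 0` and `(x, α) ↦ (F, G)` is a local chart (used in the proof of Lemma 3:
"consider `x` and `α` functions of `(F, s)`, where `G = s²`").  This file proves all of this and
sets up the inverse chart `Λ = (X̂, Â)` by the `C^∞` inverse function theorem, together with the
transported form of `(2a)`:  `∂Â/∂F = F ∂X̂/∂F + 2G ∂X̂/∂G`  (`Gavrilov.chart_transport`, Gavrilov's
"`F ∂x/∂F + s ∂x/∂s = ∂α/∂F`" in the variables `(F, G)`), and the values of `DΛ` at the origin.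

## Contents

* a small toolkit for `2 × 2` calculus on `ℝ × ℝ`: the covector `Gavrilov.L a b`, the matrix
  `Gavrilov.M a b c d`, the invertible matrix `Gavrilov.ME a b c d h` (explicit inverse);
* `Gavrilov.ProfileData` (the record above) and, for `D : ProfileData`: `D.gF`, `D.gG` and their
  partials `gFx, gFa, gGx, gGa`, `hasFDerivAt_gF/gG`, the identities `gavrilov_2a`,
  `gavrilov_2b`, the values at `(1, 0)`, smoothness on the strip `{|α| < 1}`;
* `D.theta = (F, G)`, its determinant `thetaDet` (`= 32` at `(1,0)`), the chart
  `D.thetaPH : OpenPartialHomeomorph (ℝ × ℝ) (ℝ × ℝ)` (source inside `{|α| < 1, det ≠ 0}`), its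
  inverse `D.lam = Λ`, `lam_zero : Λ (0,0) = (1,0)`, `hasFDerivAt_lam`, `contDiffAt_lam`, the
  column relations `thetaJ_lamW`, `thetaJ_lamZ` of `DΛ = (Dθ)⁻¹`, the transported identity
  `chart_transport`, and `lamW_zero`, `lamZ_zero`.

## References

* A. V. Gavrilov, *A steady Euler flow with compact support*, Geom. Funct. Anal. 29 (2019)
  190–197, §2.1 (definitions of `F, H, G`, the values at `(1,0)`), Lemma 2 ((2a), (2b)),
  proof of Lemma 3 (the change of variables `(x, α) ↔ (F, G)`). [`Gavrilov2019`]
-/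

noncomputable section

open Set Filter Metric Function
open scoped Topology

namespace Literature.Analysis.FluidPDE

namespace Gavrilov

/-! ### `2 × 2` calculus toolkit on `ℝ × ℝ` -/

/-- The covector `(u, v) ↦ a u + b v` on `ℝ × ℝ`. [folklore] -/
def L (a b : ℝ) : (ℝ × ℝ) →L[ℝ] ℝ :=
  a • ContinuousLinearMap.fst ℝ ℝ ℝ + b • ContinuousLinearMap.snd ℝ ℝ ℝ

/-- Evaluation of the covector `L a b`. [folklore] -/
@[simp] theorem L_apply (a b : ℝ) (v : ℝ × ℝ) : L a b v = a * v.1 + b * v.2 := by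
  simp [L]

/-- Every covector on `ℝ × ℝ` is an `L`. [folklore] -/
theorem eq_L (T : (ℝ × ℝ) →L[ℝ] ℝ) : T = L (T (1, 0)) (T (0, 1)) := by
  ext <;> simp

/-- The linear map `(u, v) ↦ (a u + b v, c u + d v)` on `ℝ × ℝ` (the matrix `[[a, b], [c, d]]`).
[folklore] -/
def M (a b c d : ℝ) : (ℝ × ℝ) →L[ℝ] (ℝ × ℝ) := (L a b).prod (L c d)

/-- Evaluation of the matrix `M a b c d`. [folklore] -/
@[simp] theorem M_apply (a b c d : ℝ) (v : ℝ × ℝ) :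
    M a b c d v = (a * v.1 + b * v.2, c * v.1 + d * v.2) := by
  simp [M]

/-- Every endomorphism of `ℝ × ℝ` is an `M`. [folklore] -/
theorem eq_M (T : (ℝ × ℝ) →L[ℝ] (ℝ × ℝ)) :
    T = M (T (1, 0)).1 (T (0, 1)).1 (T (1, 0)).2 (T (0, 1)).2 := by
  ext <;> simp

/-- The invertible matrix `[[a, b], [c, d]]` (`ad − bc ≠ 0`) as a continuous linear equivalence of
`ℝ × ℝ`, with the explicit inverse `(ad − bc)⁻¹ [[d, −b], [−c, a]]`. [folklore] -/
def ME (a b c d : ℝ) (h : a * d - b * c ≠ 0) : (ℝ × ℝ) ≃L[ℝ] (ℝ × ℝ) :=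
  ContinuousLinearEquiv.equivOfInverse (M a b c d)
    (M ((a * d - b * c)⁻¹ * d) (-((a * d - b * c)⁻¹ * b)) (-((a * d - b * c)⁻¹ * c))
      ((a * d - b * c)⁻¹ * a))
    (fun v => by
      have hinv : (a * d - b * c)⁻¹ * (a * d - b * c) = 1 := inv_mul_cancel₀ h
      ext
      · simp only [M_apply]
        linear_combination v.1 * hinv
      · simp only [M_apply]
        linear_combination v.2 * hinv)
    (fun v => by
      have hinv : (a * d - b * c)⁻¹ * (a * d - b * c) = 1 := inv_mul_cancel₀ h
      ext
      · simp only [M_apply]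
        linear_combination v.1 * hinv
      · simp only [M_apply]
        linear_combination v.2 * hinv)

/-- The underlying linear map of `ME a b c d h` is `M a b c d`. [folklore] -/
@[simp] theorem coe_ME (a b c d : ℝ) (h : a * d - b * c ≠ 0) :
    ((ME a b c d h : (ℝ × ℝ) ≃L[ℝ] (ℝ × ℝ)) : (ℝ × ℝ) →L[ℝ] (ℝ × ℝ)) = M a b c d := rfl

/-- Evaluation of `ME a b c d h`. [folklore] -/
@[simp] theorem ME_apply (a b c d : ℝ) (h : a * d - b * c ≠ 0) (v : ℝ × ℝ) :
    ME a b c d h v = (a * v.1 + b * v.2, c * v.1 + d * v.2) := by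
  simp [ME]

/-- Evaluation of the inverse of `ME a b c d h` (Cramer's rule). [folklore] -/
@[simp] theorem ME_symm_apply (a b c d : ℝ) (h : a * d - b * c ≠ 0) (v : ℝ × ℝ) :
    (ME a b c d h).symm v =
      ((a * d - b * c)⁻¹ * d * v.1 + -((a * d - b * c)⁻¹ * b) * v.2,
        -((a * d - b * c)⁻¹ * c) * v.1 + (a * d - b * c)⁻¹ * a * v.2) := by
  simp [ME]

/-- The strip `{(x, α) : |α| < 1}` where the profile is defined. [folklore] -/
def profileStrip : Set (ℝ × ℝ) := {m | |m.2| < 1}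

/-- The strip is open. [folklore] -/
theorem isOpen_profileStrip : IsOpen profileStrip :=
  isOpen_lt (continuous_abs.comp continuous_snd) continuous_const

/-- `(1, 0)` lies in the strip. [folklore] -/
theorem one_zero_mem_profileStrip : ((1 : ℝ), (0 : ℝ)) ∈ profileStrip := by
  simp [profileStrip]

/-- Derivative of a function of `x` alone. [folklore] -/
theorem hasFDerivAt_comp_fst {f : ℝ → ℝ} {f' : ℝ} {m : ℝ × ℝ} (hf : HasDerivAt f f' m.1) :
    HasFDerivAt (fun n : ℝ × ℝ => f n.1) (L f' 0) m := by
  have h := hf.hasFDerivAt.comp m hasFDerivAt_fst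
  refine h.congr_fderiv ?_
  ext <;> simp

/-- Derivative of a function of `α` alone. [folklore] -/
theorem hasFDerivAt_comp_snd {f : ℝ → ℝ} {f' : ℝ} {m : ℝ × ℝ} (hf : HasDerivAt f f' m.2) :
    HasFDerivAt (fun n : ℝ × ℝ => f n.2) (L 0 f') m := by
  have h := hf.hasFDerivAt.comp m hasFDerivAt_snd
  refine h.congr_fderiv ?_
  ext <;> simp

/-! ### The profile data -/

/-- The properties of Gavrilov's profile `ψ` (Lemma 1) and of `H` (Lemma 2) that the
construction uses, as a record: `χ = ψ'`, `H' = 4ψ + 24αχ` (Lemma 2),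
`Hχ = 6α + 12αψχ` (i.e. `H = 6α(1/ψ' + 2ψ)`, the definition of `H`; equivalent to the ODE (1)),
smoothness on `(−1, 1)`, and the initial values `ψ(0) = 1`, `ψ'(0) = −3/4`, `H(0) = 0`.
An instance is built from the power series of `GavrilovProfile.lean`.
[cite: Gavrilov2019, §2.1 Lemma 1, Lemma 2] -/
structure ProfileData where
  /-- the profile `ψ` -/
  ψ : ℝ → ℝ
  /-- its derivative `χ = ψ'` -/
  χ : ℝ → ℝ
  /-- the function `H` of Lemma 2 -/
  H : ℝ → ℝ
  hasDerivAt_ψ : ∀ a : ℝ, |a| < 1 → HasDerivAt ψ (χ a) a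
  hasDerivAt_H : ∀ a : ℝ, |a| < 1 → HasDerivAt H (4 * ψ a + 24 * a * χ a) a
  contDiffOn_ψ : ContDiffOn ℝ (⊤ : ℕ∞) ψ (Metric.ball 0 1)
  contDiffOn_χ : ContDiffOn ℝ (⊤ : ℕ∞) χ (Metric.ball 0 1)
  contDiffOn_H : ContDiffOn ℝ (⊤ : ℕ∞) H (Metric.ball 0 1)
  H_mul_χ : ∀ a : ℝ, |a| < 1 → H a * χ a = 6 * a + 12 * a * ψ a * χ a
  ψ_zero : ψ 0 = 1
  χ_zero : χ 0 = -3 / 4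
  H_zero : H 0 = 0

namespace ProfileData

variable (D : ProfileData)

/-! ### The functions `F`, `G` of Lemma 2 and their partial derivatives -/

/-- Gavrilov's `F(x, α) = −2xψ(α) + 2x³`. [cite: Gavrilov2019, §2.1 (definition of `F`)] -/
def gF (m : ℝ × ℝ) : ℝ := 2 * m.1 ^ 3 - 2 * m.1 * D.ψ m.2

/-- Gavrilov's `G(x, α) = 12x²α − F² − H(α)`. [cite: Gavrilov2019, §2.1 (definition of `G`)] -/
def gG (m : ℝ × ℝ) : ℝ := 12 * m.1 ^ 2 * m.2 - D.gF m ^ 2 - D.H m.2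

/-- `∂F/∂x = 6x² − 2ψ(α)`. [folklore] -/
def gFx (m : ℝ × ℝ) : ℝ := 6 * m.1 ^ 2 - 2 * D.ψ m.2

/-- `∂F/∂α = −2xψ'(α)`. [folklore] -/
def gFa (m : ℝ × ℝ) : ℝ := -2 * m.1 * D.χ m.2

/-- `H'(α) = 4ψ(α) + 24αψ'(α)` (Lemma 2). [cite: Gavrilov2019, §2.1 Lemma 2 (proof)] -/
def gH' (a : ℝ) : ℝ := 4 * D.ψ a + 24 * a * D.χ a

/-- `∂G/∂x = 24xα − 2F ∂F/∂x`. [folklore] -/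
def gGx (m : ℝ × ℝ) : ℝ := 24 * m.1 * m.2 - 2 * D.gF m * D.gFx m

/-- `∂G/∂α = 12x² − 2F ∂F/∂α − H'(α)`. [folklore] -/
def gGa (m : ℝ × ℝ) : ℝ := 12 * m.1 ^ 2 - 2 * D.gF m * D.gFa m - D.gH' m.2

variable {D}

/-- `DF = (6x² − 2ψ) dx − 2xψ' dα` on the strip. [cite: Gavrilov2019, §2.1] -/
theorem hasFDerivAt_gF {m : ℝ × ℝ} (hm : m ∈ profileStrip) :
    HasFDerivAt D.gF (L (D.gFx m) (D.gFa m)) m := by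
  have h1 : HasFDerivAt (fun n : ℝ × ℝ => n.1 ^ 3) (L (3 * m.1 ^ 2) 0) m := by
    simpa using hasFDerivAt_comp_fst (f := fun t => t ^ 3) (hasDerivAt_pow 3 m.1)
  have h2 : HasFDerivAt (fun n : ℝ × ℝ => n.1) (L 1 0) m := by
    simpa using hasFDerivAt_comp_fst (f := fun t => t) (hasDerivAt_id m.1)
  have h3 : HasFDerivAt (fun n : ℝ × ℝ => D.ψ n.2) (L 0 (D.χ m.2)) m :=
    hasFDerivAt_comp_snd (D.hasDerivAt_ψ _ hm)
  have h : HasFDerivAt D.gF _ m :=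
    ((h1.const_mul 2).sub ((h2.const_mul 2).mul h3)).congr_of_eventuallyEq
      (Eventually.of_forall fun n => by simp [gF])
  refine h.congr_fderiv ?_
  rw [eq_L (2 • L (3 * m.1 ^ 2) 0 - _)]
  simp only [gFx, gFa]
  congr 1
  all_goals simp
  all_goals ring

/-- `DG = (24xα − 2F F_x) dx + (12x² − 2F F_α − H') dα` on the strip. [cite: Gavrilov2019, §2.1] -/
theorem hasFDerivAt_gG {m : ℝ × ℝ} (hm : m ∈ profileStrip) :
    HasFDerivAt D.gG (L (D.gGx m) (D.gGa m)) m := by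
  have h1 : HasFDerivAt (fun n : ℝ × ℝ => n.1 ^ 2) (L (2 * m.1) 0) m := by
    simpa using hasFDerivAt_comp_fst (f := fun t => t ^ 2) (hasDerivAt_pow 2 m.1)
  have h2 : HasFDerivAt (fun n : ℝ × ℝ => n.2) (L 0 1) m := by
    simpa using hasFDerivAt_comp_snd (f := fun t => t) (hasDerivAt_id m.2)
  have h3 : HasFDerivAt (fun n : ℝ × ℝ => D.H n.2) (L 0 (D.gH' m.2)) m :=
    hasFDerivAt_comp_snd (D.hasDerivAt_H _ hm)
  have h4 := hasFDerivAt_gF (D := D) hm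
  have h : HasFDerivAt D.gG _ m :=
    ((((h1.const_mul 12).mul h2).sub (h4.pow 2)).sub h3).congr_of_eventuallyEq
      (Eventually.of_forall fun n => by simp [gG])
  refine h.congr_fderiv ?_
  rw [eq_L (_ - L 0 (D.gH' m.2))]
  simp only [gGx, gGa]
  congr 1
  all_goals simp
  all_goals ring

/-- **Lemma 2, (2b)**: `x ∂F/∂x − F = 4x³`. [cite: Gavrilov2019, §2.1 Lemma 2 (2b)] -/
theorem gavrilov_2b (m : ℝ × ℝ) : m.1 * D.gFx m - D.gF m = 4 * m.1 ^ 3 := by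
  simp only [gFx, gF]
  ring

/-- **Lemma 2, (2a)**: `∂G/∂x + F ∂G/∂α = 2G ∂F/∂α` on the strip — this is where the profile
equation (`H ψ' = 6α + 12αψψ'`, i.e. Gavrilov's (1)) enters. [cite: Gavrilov2019, §2.1 Lemma 2 (2a)] -/
theorem gavrilov_2a {m : ℝ × ℝ} (hm : m ∈ profileStrip) :
    D.gGx m + D.gF m * D.gGa m = 2 * D.gG m * D.gFa m := by
  have h := D.H_mul_χ m.2 hm
  simp only [gGx, gGa, gG, gFa, gFx, gF, gH']
  linear_combination (-4 * m.1) * h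

/-- Values at `(1, 0)`: `F = 0`. [cite: Gavrilov2019, §2.1] -/
@[simp] theorem gF_one_zero : D.gF (1, 0) = 0 := by
  simp [gF, D.ψ_zero]

/-- Values at `(1, 0)`: `G = 0`. [cite: Gavrilov2019, §2.1] -/
@[simp] theorem gG_one_zero : D.gG (1, 0) = 0 := by
  simp [gG, D.H_zero]

/-- Values at `(1, 0)`: `∂F/∂x = 4`. [cite: Gavrilov2019, §2.1] -/
@[simp] theorem gFx_one_zero : D.gFx (1, 0) = 4 := by
  simp [gFx, D.ψ_zero]; norm_num

/-- Values at `(1, 0)`: `∂F/∂α = 3/2`. [cite: Gavrilov2019, §2.1] -/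
@[simp] theorem gFa_one_zero : D.gFa (1, 0) = 3 / 2 := by
  simp [gFa, D.χ_zero]; norm_num

/-- Values at `(1, 0)`: `∂G/∂x = 0`. [cite: Gavrilov2019, §2.1] -/
@[simp] theorem gGx_one_zero : D.gGx (1, 0) = 0 := by
  simp [gGx]

/-- `H'(0) = 4`. [folklore] -/
@[simp] theorem gH'_zero : D.gH' 0 = 4 := by
  simp [gH', D.ψ_zero]

/-- Values at `(1, 0)`: `∂G/∂α = 8`. [cite: Gavrilov2019, §2.1] -/
@[simp] theorem gGa_one_zero : D.gGa (1, 0) = 8 := by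
  simp [gGa]; norm_num

/-! ### Smoothness of `F`, `G` and of their partials on the strip -/

/-- Composition of a function smooth on `(−1, 1)` with the projection `(x, α) ↦ α` is smooth on
the strip. [folklore] -/
theorem contDiffOn_comp_snd_strip {f : ℝ → ℝ} {n : WithTop ℕ∞}
    (hf : ContDiffOn ℝ n f (Metric.ball 0 1)) :
    ContDiffOn ℝ n (fun m : ℝ × ℝ => f m.2) profileStrip := by
  refine hf.comp contDiffOn_snd fun m hm => ?_
  simpa [profileStrip, mem_ball_zero_iff] using hm

/-- `F` is smooth on the strip. [folklore] -/
theorem contDiffOn_gF : ContDiffOn ℝ (⊤ : ℕ∞) D.gF profileStrip := by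
  have h : ContDiffOn ℝ (⊤ : ℕ∞) (fun m : ℝ × ℝ => 2 * m.1 ^ 3 - 2 * m.1 * D.ψ m.2)
      profileStrip :=
    ((contDiffOn_const.mul (contDiffOn_fst.pow 3)).sub
      ((contDiffOn_const.mul contDiffOn_fst).mul (contDiffOn_comp_snd_strip D.contDiffOn_ψ)))
  exact h

/-- `G` is smooth on the strip. [folklore] -/
theorem contDiffOn_gG : ContDiffOn ℝ (⊤ : ℕ∞) D.gG profileStrip := by
  have h : ContDiffOn ℝ (⊤ : ℕ∞) (fun m : ℝ × ℝ => 12 * m.1 ^ 2 * m.2 - D.gF m ^ 2 - D.H m.2)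
      profileStrip :=
    (((contDiffOn_const.mul (contDiffOn_fst.pow 2)).mul contDiffOn_snd).sub
      (contDiffOn_gF.pow 2)).sub (contDiffOn_comp_snd_strip D.contDiffOn_H)
  exact h

/-- `∂F/∂x` is smooth on the strip. [folklore] -/
theorem contDiffOn_gFx : ContDiffOn ℝ (⊤ : ℕ∞) D.gFx profileStrip := by
  have h : ContDiffOn ℝ (⊤ : ℕ∞) (fun m : ℝ × ℝ => 6 * m.1 ^ 2 - 2 * D.ψ m.2) profileStrip :=
    (contDiffOn_const.mul (contDiffOn_fst.pow 2)).sub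
      (contDiffOn_const.mul (contDiffOn_comp_snd_strip D.contDiffOn_ψ))
  exact h

/-- `∂F/∂α` is smooth on the strip. [folklore] -/
theorem contDiffOn_gFa : ContDiffOn ℝ (⊤ : ℕ∞) D.gFa profileStrip := by
  have h : ContDiffOn ℝ (⊤ : ℕ∞) (fun m : ℝ × ℝ => -2 * m.1 * D.χ m.2) profileStrip :=
    (contDiffOn_const.mul contDiffOn_fst).mul (contDiffOn_comp_snd_strip D.contDiffOn_χ)
  exact h

/-- `H'` composed with the projection is smooth on the strip. [folklore] -/
theorem contDiffOn_gH' : ContDiffOn ℝ (⊤ : ℕ∞) (fun m : ℝ × ℝ => D.gH' m.2) profileStrip := by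
  have h : ContDiffOn ℝ (⊤ : ℕ∞) (fun m : ℝ × ℝ => 4 * D.ψ m.2 + 24 * m.2 * D.χ m.2)
      profileStrip :=
    (contDiffOn_const.mul (contDiffOn_comp_snd_strip D.contDiffOn_ψ)).add
      ((contDiffOn_const.mul contDiffOn_snd).mul (contDiffOn_comp_snd_strip D.contDiffOn_χ))
  exact h

/-- `∂G/∂x` is smooth on the strip. [folklore] -/
theorem contDiffOn_gGx : ContDiffOn ℝ (⊤ : ℕ∞) D.gGx profileStrip := by
  have h : ContDiffOn ℝ (⊤ : ℕ∞) (fun m : ℝ × ℝ => 24 * m.1 * m.2 - 2 * D.gF m * D.gFx m)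
      profileStrip :=
    ((contDiffOn_const.mul contDiffOn_fst).mul contDiffOn_snd).sub
      ((contDiffOn_const.mul contDiffOn_gF).mul contDiffOn_gFx)
  exact h

/-- `∂G/∂α` is smooth on the strip. [folklore] -/
theorem contDiffOn_gGa : ContDiffOn ℝ (⊤ : ℕ∞) D.gGa profileStrip := by
  have h : ContDiffOn ℝ (⊤ : ℕ∞)
      (fun m : ℝ × ℝ => 12 * m.1 ^ 2 - 2 * D.gF m * D.gFa m - D.gH' m.2) profileStrip :=
    ((contDiffOn_const.mul (contDiffOn_fst.pow 2)).sub
      ((contDiffOn_const.mul contDiffOn_gF).mul contDiffOn_gFa)).sub contDiffOn_gH'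
  exact h

/-! ### The chart `θ = (F, G)`, its determinant and the inverse chart `Λ` -/

variable (D)

/-- Gavrilov's change of variables `θ(x, α) = (F(x, α), G(x, α))` (proof of Lemma 3).
[cite: Gavrilov2019, §2.2 Lemma 3 (proof)] -/
def theta (m : ℝ × ℝ) : ℝ × ℝ := (D.gF m, D.gG m)

/-- The Jacobian determinant `∂(F, G)/∂(x, α)`. [cite: Gavrilov2019, §2.2 Lemma 3 (proof)] -/
def thetaDet (m : ℝ × ℝ) : ℝ := D.gFx m * D.gGa m - D.gFa m * D.gGx m

/-- The chart domain: the strip minus the zero set of the Jacobian determinant. [folklore] -/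
def chartDom : Set (ℝ × ℝ) := profileStrip ∩ {m | D.thetaDet m ≠ 0}

variable {D}

/-- `θ(1, 0) = (0, 0)`. [cite: Gavrilov2019, §2.1] -/
@[simp] theorem theta_one_zero : D.theta (1, 0) = (0, 0) := by
  simp [theta]

/-- `∂(F, G)/∂(x, α)(1, 0) = 32` (Gavrilov: "`= 32 ≠ 0`"). [cite: Gavrilov2019, §2.2 Lemma 3 (proof)] -/
@[simp] theorem thetaDet_one_zero : D.thetaDet (1, 0) = 32 := by
  simp [thetaDet]
  norm_num

/-- The Jacobian determinant is continuous on the strip. [folklore] -/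
theorem continuousOn_thetaDet : ContinuousOn D.thetaDet profileStrip :=
  ((contDiffOn_gFx.continuousOn).mul contDiffOn_gGa.continuousOn).sub
    ((contDiffOn_gFa.continuousOn).mul contDiffOn_gGx.continuousOn)

/-- The chart domain is open. [folklore] -/
theorem isOpen_chartDom : IsOpen D.chartDom :=
  continuousOn_thetaDet.isOpen_inter_preimage isOpen_profileStrip isOpen_compl_singleton

/-- `(1, 0)` lies in the chart domain. [folklore] -/
theorem one_zero_mem_chartDom : ((1 : ℝ), (0 : ℝ)) ∈ D.chartDom :=
  ⟨one_zero_mem_profileStrip, by simp⟩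

/-- `Dθ = [[F_x, F_α], [G_x, G_α]]` on the strip. [cite: Gavrilov2019, §2.2 Lemma 3 (proof)] -/
theorem hasFDerivAt_theta {m : ℝ × ℝ} (hm : m ∈ profileStrip) :
    HasFDerivAt D.theta (M (D.gFx m) (D.gFa m) (D.gGx m) (D.gGa m)) m :=
  (hasFDerivAt_gF hm).prodMk (hasFDerivAt_gG hm)

/-- `Dθ` as an invertible matrix on the chart domain. [folklore] -/
theorem hasFDerivAt_theta' {m : ℝ × ℝ} (hm : m ∈ D.chartDom) :
    HasFDerivAt D.theta
      ((ME (D.gFx m) (D.gFa m) (D.gGx m) (D.gGa m) hm.2 : (ℝ × ℝ) ≃L[ℝ] (ℝ × ℝ)) :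
        (ℝ × ℝ) →L[ℝ] (ℝ × ℝ)) m := by
  rw [coe_ME]
  exact hasFDerivAt_theta hm.1

/-- `θ` is smooth on the strip. [folklore] -/
theorem contDiffOn_theta : ContDiffOn ℝ (⊤ : ℕ∞) D.theta profileStrip :=
  contDiffOn_gF.prodMk contDiffOn_gG

/-- `θ` is smooth at every point of the strip. [folklore] -/
theorem contDiffAt_theta {m : ℝ × ℝ} (hm : m ∈ profileStrip) : ContDiffAt ℝ (⊤ : ℕ∞) D.theta m :=
  contDiffOn_theta.contDiffAt (isOpen_profileStrip.mem_nhds hm)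

variable (D)

/-- **The hodograph chart** `(x, α) ↦ (F, G)` near `(1, 0)` as an open partial homeomorphism
(inverse function theorem, `∂(F,G)/∂(x,α)(1,0) = 32 ≠ 0`), restricted to the chart domain.
[cite: Gavrilov2019, §2.2 Lemma 3 (proof: "consider `x` and `α` functions of `(F, s)`")] -/
def thetaPH : OpenPartialHomeomorph (ℝ × ℝ) (ℝ × ℝ) :=
  ((contDiffAt_theta (D := D) one_zero_mem_profileStrip).toOpenPartialHomeomorph D.theta
    (hasFDerivAt_theta' (D := D) one_zero_mem_chartDom) (by simp)).restrOpen D.chartDom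
    isOpen_chartDom

/-- The inverse chart `Λ = (X̂, Â) : (F, G) ↦ (x, α)`. [cite: Gavrilov2019, §2.2 Lemma 3 (proof)] -/
def lam : ℝ × ℝ → ℝ × ℝ := D.thetaPH.symm

/-- The first column `∂Λ/∂F = (∂X̂/∂F, ∂Â/∂F)` of `DΛ`. [folklore] -/
def lamW (n : ℝ × ℝ) : ℝ × ℝ := fderiv ℝ D.lam n (1, 0)

/-- The second column `∂Λ/∂G = (∂X̂/∂G, ∂Â/∂G)` of `DΛ`. [folklore] -/
def lamZ (n : ℝ × ℝ) : ℝ × ℝ := fderiv ℝ D.lam n (0, 1)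

variable {D}

/-- The chart is `θ` as a function. [folklore] -/
@[simp] theorem thetaPH_coe : (D.thetaPH : ℝ × ℝ → ℝ × ℝ) = D.theta := rfl

/-- The chart's source lies in the chart domain. [folklore] -/
theorem thetaPH_source_subset : D.thetaPH.source ⊆ D.chartDom := fun _ hm => hm.2

/-- `(1, 0)` is in the source of the chart. [folklore] -/
theorem one_zero_mem_thetaPH_source : ((1 : ℝ), (0 : ℝ)) ∈ D.thetaPH.source :=
  ⟨ContDiffAt.mem_toOpenPartialHomeomorph_source _ _ _, one_zero_mem_chartDom⟩

/-- `(0, 0) = θ(1, 0)` is in the target of the chart. [folklore] -/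
theorem zero_mem_thetaPH_target : ((0 : ℝ), (0 : ℝ)) ∈ D.thetaPH.target := by
  have h := D.thetaPH.map_source one_zero_mem_thetaPH_source
  rwa [thetaPH_coe, theta_one_zero] at h

/-- The target of the chart is open. [folklore] -/
theorem isOpen_thetaPH_target : IsOpen D.thetaPH.target := D.thetaPH.open_target

/-- `Λ(0, 0) = (1, 0)`. [cite: Gavrilov2019, §2.2 Lemma 3] -/
@[simp] theorem lam_zero : D.lam (0, 0) = (1, 0) := by
  have h := D.thetaPH.left_inv one_zero_mem_thetaPH_source
  rwa [thetaPH_coe, theta_one_zero] at h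

/-- `Λ` maps the target into the chart domain. [folklore] -/
theorem lam_mem_chartDom {n : ℝ × ℝ} (hn : n ∈ D.thetaPH.target) : D.lam n ∈ D.chartDom :=
  thetaPH_source_subset (D.thetaPH.map_target hn)

/-- `θ ∘ Λ = id` on the target. [folklore] -/
theorem theta_lam {n : ℝ × ℝ} (hn : n ∈ D.thetaPH.target) : D.theta (D.lam n) = n :=
  D.thetaPH.right_inv hn

/-- `F(Λ(n)) = n.1` on the target. [folklore] -/
theorem gF_lam {n : ℝ × ℝ} (hn : n ∈ D.thetaPH.target) : D.gF (D.lam n) = n.1 :=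
  congrArg Prod.fst (theta_lam hn)

/-- `G(Λ(n)) = n.2` on the target. [folklore] -/
theorem gG_lam {n : ℝ × ℝ} (hn : n ∈ D.thetaPH.target) : D.gG (D.lam n) = n.2 :=
  congrArg Prod.snd (theta_lam hn)

/-- `DΛ = (Dθ ∘ Λ)⁻¹` on the target. [cite: Gavrilov2019, §2.2 Lemma 3 (proof)] -/
theorem hasFDerivAt_lam {n : ℝ × ℝ} (hn : n ∈ D.thetaPH.target) :
    HasFDerivAt D.lam
      (((ME (D.gFx (D.lam n)) (D.gFa (D.lam n)) (D.gGx (D.lam n)) (D.gGa (D.lam n))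
        (lam_mem_chartDom hn).2).symm : (ℝ × ℝ) ≃L[ℝ] (ℝ × ℝ)) : (ℝ × ℝ) →L[ℝ] (ℝ × ℝ)) n :=
  D.thetaPH.hasFDerivAt_symm hn (hasFDerivAt_theta' (lam_mem_chartDom hn))

/-- `Λ` is smooth at every point of the target. [folklore] -/
theorem contDiffAt_lam {n : ℝ × ℝ} (hn : n ∈ D.thetaPH.target) : ContDiffAt ℝ (⊤ : ℕ∞) D.lam n :=
  D.thetaPH.contDiffAt_symm hn (hasFDerivAt_theta' (lam_mem_chartDom hn))
    (contDiffAt_theta (lam_mem_chartDom hn).1)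

/-- `Λ` is smooth on the target. [folklore] -/
theorem contDiffOn_lam : ContDiffOn ℝ (⊤ : ℕ∞) D.lam D.thetaPH.target := fun _ hn =>
  (contDiffAt_lam hn).contDiffWithinAt

/-- The formula for `DΛ` on the target. [folklore] -/
theorem fderiv_lam {n : ℝ × ℝ} (hn : n ∈ D.thetaPH.target) :
    fderiv ℝ D.lam n =
      (((ME (D.gFx (D.lam n)) (D.gFa (D.lam n)) (D.gGx (D.lam n)) (D.gGa (D.lam n))
        (lam_mem_chartDom hn).2).symm : (ℝ × ℝ) ≃L[ℝ] (ℝ × ℝ)) : (ℝ × ℝ) →L[ℝ] (ℝ × ℝ)) :=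
  (hasFDerivAt_lam hn).fderiv

/-- `n ↦ DΛ(n)` is smooth on the target. [folklore] -/
theorem contDiffOn_fderiv_lam : ContDiffOn ℝ (⊤ : ℕ∞) (fun n => fderiv ℝ D.lam n) D.thetaPH.target :=
  contDiffOn_lam.fderiv_of_isOpen isOpen_thetaPH_target (by simp)

/-- The first column of `DΛ` is smooth on the target. [folklore] -/
theorem contDiffOn_lamW : ContDiffOn ℝ (⊤ : ℕ∞) D.lamW D.thetaPH.target :=
  contDiffOn_fderiv_lam.clm_apply contDiffOn_const

/-- The second column of `DΛ` is smooth on the target. [folklore] -/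
theorem contDiffOn_lamZ : ContDiffOn ℝ (⊤ : ℕ∞) D.lamZ D.thetaPH.target :=
  contDiffOn_fderiv_lam.clm_apply contDiffOn_const

/-- `Dθ · ∂Λ/∂F = (1, 0)`. [folklore] -/
theorem thetaJ_lamW {n : ℝ × ℝ} (hn : n ∈ D.thetaPH.target) :
    D.gFx (D.lam n) * (D.lamW n).1 + D.gFa (D.lam n) * (D.lamW n).2 = 1 ∧
      D.gGx (D.lam n) * (D.lamW n).1 + D.gGa (D.lam n) * (D.lamW n).2 = 0 := by
  set E := ME (D.gFx (D.lam n)) (D.gFa (D.lam n)) (D.gGx (D.lam n)) (D.gGa (D.lam n))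
    (lam_mem_chartDom hn).2 with hE
  have hw : D.lamW n = E.symm (1, 0) := by
    rw [lamW, fderiv_lam hn]
    rfl
  have h := E.apply_symm_apply (1, 0)
  rw [← hw, hE, ME_apply] at h
  exact ⟨congrArg Prod.fst h, congrArg Prod.snd h⟩

/-- `Dθ · ∂Λ/∂G = (0, 1)`. [folklore] -/
theorem thetaJ_lamZ {n : ℝ × ℝ} (hn : n ∈ D.thetaPH.target) :
    D.gFx (D.lam n) * (D.lamZ n).1 + D.gFa (D.lam n) * (D.lamZ n).2 = 0 ∧
      D.gGx (D.lam n) * (D.lamZ n).1 + D.gGa (D.lam n) * (D.lamZ n).2 = 1 := by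
  set E := ME (D.gFx (D.lam n)) (D.gFa (D.lam n)) (D.gGx (D.lam n)) (D.gGa (D.lam n))
    (lam_mem_chartDom hn).2 with hE
  have hz : D.lamZ n = E.symm (0, 1) := by
    rw [lamZ, fderiv_lam hn]
    rfl
  have h := E.apply_symm_apply (0, 1)
  rw [← hz, hE, ME_apply] at h
  exact ⟨congrArg Prod.fst h, congrArg Prod.snd h⟩

/-- **The transported identity (2a)**: `∂Â/∂F = F ∂X̂/∂F + 2G ∂X̂/∂G` on the target
(Gavrilov's "`F ∂x/∂F + s ∂x/∂s = ∂α/∂F`", written in the variables `(F, G)`, `G = s²`).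
[cite: Gavrilov2019, §2.2 Lemma 3 (proof)] -/
theorem chart_transport {n : ℝ × ℝ} (hn : n ∈ D.thetaPH.target) :
    (D.lamW n).2 = n.1 * (D.lamW n).1 + 2 * n.2 * (D.lamZ n).1 := by
  obtain ⟨h1, h2⟩ := thetaJ_lamW hn
  obtain ⟨h3, h4⟩ := thetaJ_lamZ hn
  have h5 := gavrilov_2a (D := D) (lam_mem_chartDom hn).1
  rw [gF_lam hn, gG_lam hn] at h5
  have hdet : D.gFx (D.lam n) * D.gGa (D.lam n) - D.gFa (D.lam n) * D.gGx (D.lam n) ≠ 0 :=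
    (lam_mem_chartDom hn).2
  apply mul_left_cancel₀ hdet
  linear_combination (D.gFx (D.lam n) + n.1 * D.gFa (D.lam n)) * h2 -
    (D.gGx (D.lam n) + n.1 * D.gGa (D.lam n)) * h1 - 2 * n.2 * D.gGa (D.lam n) * h3 +
    2 * n.2 * D.gFa (D.lam n) * h4 - h5

/-- `det Dθ(Λ n) · det DΛ(n) = 1`. [folklore] -/
theorem thetaDet_mul_lamDet {n : ℝ × ℝ} (hn : n ∈ D.thetaPH.target) :
    D.thetaDet (D.lam n) * ((D.lamW n).1 * (D.lamZ n).2 - (D.lamZ n).1 * (D.lamW n).2) = 1 := by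
  obtain ⟨h1, h2⟩ := thetaJ_lamW hn
  obtain ⟨h3, h4⟩ := thetaJ_lamZ hn
  unfold thetaDet
  linear_combination (D.gGx (D.lam n) * (D.lamZ n).1 + D.gGa (D.lam n) * (D.lamZ n).2) * h1 +
    h4 - (D.gFx (D.lam n) * (D.lamZ n).1 + D.gFa (D.lam n) * (D.lamZ n).2) * h2

/-- `∂Λ/∂F (0, 0) = (1/4, 0)`. [cite: Gavrilov2019, §2.2 Lemma 3 (proof)] -/
@[simp] theorem lamW_zero : D.lamW (0, 0) = (1 / 4, 0) := by
  rw [lamW, fderiv_lam zero_mem_thetaPH_target]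
  simp
  norm_num

/-- `∂Λ/∂G (0, 0) = (−3/64, 1/8)` (in particular `∂Â/∂G(0,0) = 1/8`, Gavrilov's
"`∂Φ²/∂G(0,0) = 1/16`" squared-scale). [cite: Gavrilov2019, §2.2 Lemma 3 (proof)] -/
@[simp] theorem lamZ_zero : D.lamZ (0, 0) = (-3 / 64, 1 / 8) := by
  rw [lamZ, fderiv_lam zero_mem_thetaPH_target]
  simp
  norm_num

end ProfileData

end Gavrilov

end Literature.Analysis.FluidPDE
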